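/-
Copyright (c) 2026 the pub-hodgecm-mathlib formalisation cell (harness21).  Prover seat hodgecm-mathlib-LH4-p14 (g9) (L1 valve hand; LEAD F0P6-plan (g16) BATCH #280 (2),
(dec-2-pay) F2, sub-bricks F2β₀∕F2δ₀), Track B «K2-LIT» ∕ hLiu418 #184♮, socket #41 KIND 1, package (K1b-♮): THE A-LINE TWINS — the corner chart `blkD (·, 1)` of the FIRST
summand at the other corner enumeration `eV (1,0) = 0` (so `eV (0,0) = 1`: the A-line sits on H-coordinate `1`, the SAME corner pattern `ι` and the SAME frame slot `1` as the B-line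
at `eV (1,0) = 1`) read in the Levi-ADAPTED frames (over ★ p865320 F2β + ★/📤 F2δ).  THEOREMS ONLY (no `def`, no `instance`, no notation, no named-fact hypothesis, no `sorry`).
-/
import Summits.HodgeConjecture.HodgeConjecture.Theorems.K2LiuKindOneLineCornerFrameWeylUnip   -- F2δ (this seat): `blk ↔ archAt` dictionary, Weyl∕unipotent block readings, slot product (brings ★ F2β)
import HarnessLib

/-!
# Crux `HLiu418`, socket #41, KIND 1 (K1-b♮), (dec-2-pay) F2β₀∕F2δ₀ — `K2LiuKindOneLineCornerFrameReadingInl`: THE A-LINE CORNER IN THE ADAPTED FRAME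

Cell `hodgecm-mathlib`, hLiu418 = `stmt-HodgeConjecture-24832` (helper lane, count-neutral); squad K2 ∕ K2Liu, socket #41, KIND 1.  The A-line chain `hchain₀` of ★ p865308
`K2LiuKindOneLineBlockLetterOfRecordLamInl.blockLetter_inl_rate_of_record_lam` reads the family `y ↦ f_s(blkD(y, 1)·g)` on the FIRST summand with the SAME corner pattern `ι`
(index `1`) and the SAME frames `T′σ` as the B-line chain — consistent exactly when `eV (1,0) = 0`, i.e. `eV (0,0) = 1`: then `idxSplit eV eA eB 1 = inl (eA (0,0))` and the A-summand
is the SECOND index of each copy.  So the twins of ★ F2β∕F2δ are the same slot algebra at slot `1` (letter `t₁(σ) = Re σ(dA₀·dW₀)`):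
* §1 `eV_symm_of_he0`, `idxSplit_of_he0`, **`reindex_blockDiag_one_eq_corner_inl`** (`e₂⁻¹·σ_D⁻¹[diag(Y, 1)]·e₂ = ι(e₂⁻¹·Y·e₂)` at `eV (1,0) = 0`), `dVdW_slot_one_inl`;
* §2 **`reindex_archAt_blkD_inl`** (`e₂⁻¹·((blkD(x,1))_∞)_σ·e₂ = ι(e₂⁻¹·(x_∞)_σ·e₂)`), **`frame_archAt_blkD_inl_adapted`** (the F2β HEAD twin) and
  **`frame_archAt_blkD_inl_weyl_unip_adapted`** (the F2δ HEAD twin: `T′σ·(e₂⁻¹((blkD(w_Δ·u, 1))_∞)_σe₂)·T′σ⁻¹ = ι(m(cτ′,cτ)·J₁·n₁(2cτ′·x_σ))`, `u ∈ N_Δ^{(A)}(𝔸)`).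
[Kudla1994, §2] [Shimura1997, §18.1 (18.4), §A3] [HarrisKudlaSweet1996, §1 (1.11)] [BorelJacquet1979, §4.1].
HONEST LABEL.  Count-neutral helper; closes no socket: `HC_CM` is proved only modulo the 7 printed citations (2 remaining named inputs: hLiu418 = `stmt-HodgeConjecture-24832`,
h413 = `stmt-HodgeConjecture-24833`) until rung 0 closes.

## References
* [Kudla1994] S. Kudla, Israel J. Math. 87 (1994), §2.  [Shimura1997] G. Shimura, CBMS 93 (1997), §18.1 (18.4), §A3.  [HarrisKudlaSweet1996] J. AMS 9 (1996), §1 (1.11).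
* [BorelJacquet1979] A. Borel, H. Jacquet, PSPM 33.1 (1979), §4.1.
-/

set_option autoImplicit false
set_option linter.dupNamespace false -- the mandated namespace repeats `HodgeConjecture.HodgeConjecture`

noncomputable section

open scoped Classical
open scoped Matrix
open Complex Matrix NumberField IsDedekindDomain
open Literature.NumberTheory.Automorphic Literature.NumberTheory.GaloisRepresentations
open Literature.NumberTheory.GelbartRogawski1991 Literature.NumberTheory.GelbartRogawski1991.GRConstruction
open Literature.NumberTheory.GelbartRogawski1991.UnitaryDualPair

namespace Summit.HodgeConjecture.HodgeConjecture.Cruxes.HLiu418.K2LiuKindOneLineCornerFrameReadingInl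

open K2LiuKindOneLineCornerFrameReading K2LiuKindOneLineCornerFrameWeylUnip
open Literature.NumberTheory.K2Lit.SiegelDoubled

/-! ## §1 The index shuffle at the other corner: `eV (1,0) = 0` puts the `A`-line at the SECOND index of each copy -/

section Index

variable {n₁ n₂ : ℕ} (eV : Fin 2 × Fin 1 ≃ Fin 2) (eA : Fin 1 × Fin 1 ≃ Fin n₁) (eB : Fin 1 × Fin 1 ≃ Fin n₂)

/-- `eV⁻¹ 1 = (0, 0)` and `eV⁻¹ 0 = (1, 0)` when `eV (1,0) = 0`. [folklore] -/
theorem eV_symm_of_he0 (he : eV (1, 0) = 0) : eV.symm 1 = (0, 0) ∧ eV.symm 0 = (1, 0) := by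
  have h0 : eV.symm 0 = (1, 0) := by rw [Equiv.symm_apply_eq]; exact he.symm
  refine ⟨?_, h0⟩
  have h1 : eV (0, 0) ≠ 0 := fun h => by
    have := eV.injective (h.trans he.symm)
    simp at this
  rw [Equiv.symm_apply_eq]
  rcases Fin.eq_zero_or_eq_succ (eV (0, 0)) with h | ⟨j, hj⟩
  · exact absurd h h1
  · rw [hj]; exact (congrArg Fin.succ (Fin.eq_zero j)).trans rfl |>.symm

/-- **`idxSplit eV eA eB 1 = inl (eA (0,0))`** (the `A`-line is the second index) and **`idxSplit eV eA eB 0 = inr (eB (0,0))`**, when `eV (1,0) = 0`. [cite: Kudla1994, §2] -/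
theorem idxSplit_of_he0 (he : eV (1, 0) = 0) :
    idxSplit eV eA eB 1 = Sum.inl (eA (0, 0)) ∧ idxSplit eV eA eB 0 = Sum.inr (eB (0, 0)) := by
  obtain ⟨h1, h0⟩ := eV_symm_of_he0 eV he
  have e1 : (finSumFinEquiv (m := 1) (n := 1)).symm 1 = Sum.inr 0 :=
    (finSumFinEquiv_symm_apply_natAdd (m := 1) (n := 1) 0).trans rfl |>.symm.symm
  have e0 : (finSumFinEquiv (m := 1) (n := 1)).symm 0 = Sum.inl 0 :=
    finSumFinEquiv_symm_apply_castAdd (m := 1) (n := 1) 0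
  constructor
  · simp [idxSplit, h1, e0]
  · simp [idxSplit, h0, e1]

variable (ι : Matrix (Fin 1 ⊕ Fin 1) (Fin 1 ⊕ Fin 1) ℂ → Matrix (Fin 2 ⊕ Fin 2) (Fin 2 ⊕ Fin 2) ℂ)
    (hι : ∀ x, ι x = fromBlocks !![1, 0; 0, x (Sum.inl 0) (Sum.inl 0)] !![0, 0; 0, x (Sum.inl 0) (Sum.inr 0)] !![0, 0; 0, x (Sum.inr 0) (Sum.inl 0)] !![1, 0; 0, x (Sum.inr 0) (Sum.inr 0)])

include hι in
/-- **THE SEE-SAW CHART OF `diag(Y, 1)` READ ON `Fin 2 ⊕ Fin 2` IS THE CORNER** when `eV (1,0) = 0`: `e₂⁻¹ · σ_D⁻¹[diag(Y, 1)] · e₂ = ι(e₂⁻¹ · Y · e₂)` (`n₁ = n₂ = 1`).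
[cite: Kudla1994, §2] -/
theorem reindex_blockDiag_one_eq_corner_inl (eA eB : Fin 1 × Fin 1 ≃ Fin 1) (he : eV (1, 0) = 0) (Y : Matrix (Fin (1 + 1)) (Fin (1 + 1)) ℂ) :
    Matrix.reindex (finSumFinEquiv (m := 2) (n := 2)).symm (finSumFinEquiv (m := 2) (n := 2)).symm
        (Matrix.reindex (idxSplitD eV eA eB).symm (idxSplitD eV eA eB).symm (fromBlocks Y 0 0 (1 : Matrix (Fin (1 + 1)) (Fin (1 + 1)) ℂ))) =
      ι (Matrix.reindex (finSumFinEquiv (m := 1) (n := 1)).symm (finSumFinEquiv (m := 1) (n := 1)).symm Y) := by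
  obtain ⟨h1, h0⟩ := idxSplit_of_he0 eV eA eB he
  have hA : eA (0, 0) = 0 := Fin.eq_zero _
  have hB : eB (0, 0) = 0 := Fin.eq_zero _
  rw [hA] at h1
  rw [hB] at h0
  have s0 : idxSplitD eV eA eB (finSumFinEquiv (Sum.inl 0)) = Sum.inr (finSumFinEquiv (m := 1) (n := 1) (Sum.inl 0)) := by
    rw [idxSplitD_apply_inl, h0, Sum.map_inr]
  have s1 : idxSplitD eV eA eB (finSumFinEquiv (Sum.inl 1)) = Sum.inl (finSumFinEquiv (m := 1) (n := 1) (Sum.inl 0)) := by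
    rw [idxSplitD_apply_inl, h1, Sum.map_inl]
  have s2 : idxSplitD eV eA eB (finSumFinEquiv (Sum.inr 0)) = Sum.inr (finSumFinEquiv (m := 1) (n := 1) (Sum.inr 0)) := by
    rw [idxSplitD_apply_inr, h0, Sum.map_inr]
  have s3 : idxSplitD eV eA eB (finSumFinEquiv (Sum.inr 1)) = Sum.inl (finSumFinEquiv (m := 1) (n := 1) (Sum.inr 0)) := by
    rw [idxSplitD_apply_inr, h1, Sum.map_inl]
  have one11 : (1 : Matrix (Fin (1 + 1)) (Fin (1 + 1)) ℂ) (finSumFinEquiv (Sum.inl 0)) (finSumFinEquiv (Sum.inl 0)) = 1 := one_apply_eq _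
  have one22 : (1 : Matrix (Fin (1 + 1)) (Fin (1 + 1)) ℂ) (finSumFinEquiv (Sum.inr 0)) (finSumFinEquiv (Sum.inr 0)) = 1 := one_apply_eq _
  have one12 : (1 : Matrix (Fin (1 + 1)) (Fin (1 + 1)) ℂ) (finSumFinEquiv (Sum.inl 0)) (finSumFinEquiv (Sum.inr 0)) = 0 :=
    one_apply_ne (by decide)
  have one21 : (1 : Matrix (Fin (1 + 1)) (Fin (1 + 1)) ℂ) (finSumFinEquiv (Sum.inr 0)) (finSumFinEquiv (Sum.inl 0)) = 0 :=
    one_apply_ne (by decide)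
  rw [hι]
  ext i j
  rcases i with i | i <;> rcases j with j | j <;> fin_cases i <;> fin_cases j <;>
    simp [Matrix.reindex_apply, Matrix.submatrix_apply, fromBlocks, s0, s1, s2, s3, one11, one22, one12, one21]

end Index

/-! ## §2 The archimedean component of `blkD (x, 1)` and the adapted-frame readings -/

section Adapted

variable (L : Type) [Field L] [NumberField L] [IsCMField L]
variable (eV : Fin 2 × Fin 1 ≃ Fin 2) (eA eB : Fin 1 × Fin 1 ≃ Fin 1)
  (dA : Fin 1 → L) (hdA : ∀ i, IsCMField.complexConj L (dA i) = dA i)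
  (dB : Fin 1 → L) (hdB : ∀ i, IsCMField.complexConj L (dB i) = dB i)
  (dV : Fin 2 → L) (hdV : ∀ i, IsCMField.complexConj L (dV i) = dV i)
  (hVA : ∀ i, dV (Fin.castAdd 1 i) = dA i) (hVB : ∀ j, dV (Fin.natAdd 1 j) = dB j)
  (dW : Fin 1 → L) (hdW : ∀ i, IsCMField.complexConj L (dW i) = dW i)
  (ι : Matrix (Fin 1 ⊕ Fin 1) (Fin 1 ⊕ Fin 1) ℂ → Matrix (Fin 2 ⊕ Fin 2) (Fin 2 ⊕ Fin 2) ℂ)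
  (hι : ∀ x, ι x = fromBlocks !![1, 0; 0, x (Sum.inl 0) (Sum.inl 0)] !![0, 0; 0, x (Sum.inl 0) (Sum.inr 0)] !![0, 0; 0, x (Sum.inr 0) (Sum.inl 0)] !![1, 0; 0, x (Sum.inr 0) (Sum.inr 0)])

omit [NumberField L] [IsCMField L] in
include hVA in
/-- with `eV (1,0) = 0` the slot-`1` gram letter of `V` is the `A`-line's: `dV (eV⁻¹ 1).1 · dW (eV⁻¹ 1).2 = dA 0 · dW 0`. [cite: Kudla1994, §2] -/
theorem dVdW_slot_one_inl (he : eV (1, 0) = 0) : dV (eV.symm 1).1 * dW (eV.symm 1).2 = dA 0 * dW 0 := by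
  rw [(eV_symm_of_he0 eV he).1]
  exact congrArg (· * dW 0) (hVA 0)

include hι in
/-- **THE ARCHIMEDEAN COMPONENT OF THE FIRST-SUMMAND CORNER CHART IS THE CORNER** (`eV (1,0) = 0`): `e₂⁻¹ · ((blkD(x,1))_∞)_σ · e₂ = ι(e₂⁻¹ · (x_∞)_σ · e₂)`
(★ (e2) `coe_archPart_blkD` at `(x, 1)`, `(1)_∞ = 1`; ★ `coe_archAt_eq_map`; §1). [cite: Kudla1994, §2] [cite: BorelJacquet1979, §4.1] -/
theorem reindex_archAt_blkD_inl (he : eV (1, 0) = 0) (σ : {w : InfinitePlace L // w.IsComplex}) (hw : IsCMField.complexConj L • σ.1 = σ.1)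
    (x : HA L eA dA hdA dW hdW) :
    Matrix.reindex (finSumFinEquiv (m := 2) (n := 2)).symm (finSumFinEquiv (m := 2) (n := 2)).symm
        (((UnitaryGroup.archAt (Fp L) L (IsCMField.complexConj L) (2 + 2) (hermD L eV dV hdV dW hdW) σ hw (IsCMField.complexConj_ne_one L)
            (UnitaryGroup.archPart (Fp L) L (IsCMField.complexConj L) (2 + 2) (hermD L eV dV hdV dW hdW)
              (blkD L eV eA eB dA hdA dB hdB dV hdV hVA hVB dW hdW (x, 1))) :
            UnitaryGroup.archLocal L (2 + 2) (hermD L eV dV hdV dW hdW) σ) : GL (Fin (2 + 2)) ℂ) : Matrix (Fin (2 + 2)) (Fin (2 + 2)) ℂ) =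
      ι (Matrix.reindex (finSumFinEquiv (m := 1) (n := 1)).symm (finSumFinEquiv (m := 1) (n := 1)).symm
        (((UnitaryGroup.archAt (Fp L) L (IsCMField.complexConj L) (1 + 1) (hermD L eA dA hdA dW hdW) σ hw (IsCMField.complexConj_ne_one L)
            (UnitaryGroup.archPart (Fp L) L (IsCMField.complexConj L) (1 + 1) (hermD L eA dA hdA dW hdW) x) :
            UnitaryGroup.archLocal L (1 + 1) (hermD L eA dA hdA dW hdW) σ) : GL (Fin (1 + 1)) ℂ) : Matrix (Fin (1 + 1)) (Fin (1 + 1)) ℂ)) := by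
  have h1 : UnitaryGroup.archPart (Fp L) L (IsCMField.complexConj L) (1 + 1) (hermD L eB dB hdB dW hdW) (1 : HA L eB dB hdB dW hdW) = 1 := map_one _
  rw [K2LiuSiegelUnipotentArchPlaces.coe_archAt_eq_map L eV dV hdV dW hdW σ hw, K2LiuSiegelUnipotentArchPlaces.coe_archAt_eq_map L eA dA hdA dW hdW σ hw,
    K2LiuBlockDiagPlaces.coe_archPart_blkD L eV eA eB dA hdA dB hdB dV hdV hVA hVB dW hdW (x, 1), UnitaryGroup.coe_reindexGL, UnitaryGroup.coe_blockDiagGL]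
  dsimp only
  rw [h1, OneMemClass.coe_one, Units.val_one, map_reindex, Matrix.fromBlocks_map, Matrix.map_zero _ (map_zero _), Matrix.map_one _ (map_zero _) (map_one _)]
  exact reindex_blockDiag_one_eq_corner_inl eV ι hι eA eB he _

include hι in
/-- **THE A-LINE CORNER IN THE ADAPTED FRAME** (F2β HEAD twin at `eV (1,0) = 0`): at the frames (9)(10) of ★ p864905 BY VALUE, for every complex `σ` and `x ∈ H_A(𝔸)`,
`T′σ · (e₂⁻¹·((blkD(x,1))_∞)_σ·e₂) · T′σ⁻¹ = ι(T′₁σ · (e₂⁻¹·(x_∞)_σ·e₂) · T′₁σ⁻¹)`, `T′₁σ` the slot-`1` frame (letter `t₁(σ) = Re σ(dA₀·dW₀)`, `dVdW_slot_one_inl`).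
[cite: Kudla1994, §2] [cite: Shimura1997, §18.1 (18.4), §A3] -/
theorem frame_archAt_blkD_inl_adapted (he : eV (1, 0) = 0)
    (T Tinv : {w : InfinitePlace L // w.IsComplex} → Matrix (Fin 2 ⊕ Fin 2) (Fin 2 ⊕ Fin 2) ℂ)
    (hTdef : ∀ σ, T σ = Matrix.fromBlocks (diagonal (fun k => (((Real.sqrt (|(σ.1.embedding (dV (eV.symm k).1 * dW (eV.symm k).2)).re| / 2))⁻¹ : ℝ) : ℂ))) 0 0
          (diagonal (fun k => (Real.sqrt (|(σ.1.embedding (dV (eV.symm k).1 * dW (eV.symm k).2)).re| / 2) : ℂ))) *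
        fromBlocks (diagonal (fun k => (Real.sqrt (|(σ.1.embedding (dV (eV.symm k).1 * dW (eV.symm k).2)).re| / 2) : ℂ)))
          (diagonal (fun k => (Real.sqrt (|(σ.1.embedding (dV (eV.symm k).1 * dW (eV.symm k).2)).re| / 2) : ℂ)))
          (diagonal (fun k => I * ((((σ.1.embedding (dV (eV.symm k).1 * dW (eV.symm k).2)).re / |(σ.1.embedding (dV (eV.symm k).1 * dW (eV.symm k).2)).re|) *
            Real.sqrt (|(σ.1.embedding (dV (eV.symm k).1 * dW (eV.symm k).2)).re| / 2) : ℝ) : ℂ)))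
          (-diagonal (fun k => I * ((((σ.1.embedding (dV (eV.symm k).1 * dW (eV.symm k).2)).re / |(σ.1.embedding (dV (eV.symm k).1 * dW (eV.symm k).2)).re|) *
            Real.sqrt (|(σ.1.embedding (dV (eV.symm k).1 * dW (eV.symm k).2)).re| / 2) : ℝ) : ℂ))))
    (hTinvdef : ∀ σ, Tinv σ = fromBlocks (diagonal (fun k => (((Real.sqrt (|(σ.1.embedding (dV (eV.symm k).1 * dW (eV.symm k).2)).re| / 2))⁻¹ / 2 : ℝ) : ℂ)))
          (-diagonal (fun k => I * (((Real.sqrt (|(σ.1.embedding (dV (eV.symm k).1 * dW (eV.symm k).2)).re| / 2))⁻¹ *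
            ((σ.1.embedding (dV (eV.symm k).1 * dW (eV.symm k).2)).re / |(σ.1.embedding (dV (eV.symm k).1 * dW (eV.symm k).2)).re|) / 2 : ℝ) : ℂ)))
          (diagonal (fun k => (((Real.sqrt (|(σ.1.embedding (dV (eV.symm k).1 * dW (eV.symm k).2)).re| / 2))⁻¹ / 2 : ℝ) : ℂ)))
          (diagonal (fun k => I * (((Real.sqrt (|(σ.1.embedding (dV (eV.symm k).1 * dW (eV.symm k).2)).re| / 2))⁻¹ *
            ((σ.1.embedding (dV (eV.symm k).1 * dW (eV.symm k).2)).re / |(σ.1.embedding (dV (eV.symm k).1 * dW (eV.symm k).2)).re|) / 2 : ℝ) : ℂ))) *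
        Matrix.fromBlocks (diagonal (fun k => (Real.sqrt (|(σ.1.embedding (dV (eV.symm k).1 * dW (eV.symm k).2)).re| / 2) : ℂ))) 0 0
          (diagonal (fun k => (((Real.sqrt (|(σ.1.embedding (dV (eV.symm k).1 * dW (eV.symm k).2)).re| / 2))⁻¹ : ℝ) : ℂ))))
    (σ : {w : InfinitePlace L // w.IsComplex}) (hw : IsCMField.complexConj L • σ.1 = σ.1)
    (ht : ∀ k, (σ.1.embedding (dV (eV.symm k).1 * dW (eV.symm k).2)).re ≠ 0) (x : HA L eA dA hdA dW hdW) :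
    T σ * Matrix.reindex (finSumFinEquiv (m := 2) (n := 2)).symm (finSumFinEquiv (m := 2) (n := 2)).symm
        (((UnitaryGroup.archAt (Fp L) L (IsCMField.complexConj L) (2 + 2) (hermD L eV dV hdV dW hdW) σ hw (IsCMField.complexConj_ne_one L)
            (UnitaryGroup.archPart (Fp L) L (IsCMField.complexConj L) (2 + 2) (hermD L eV dV hdV dW hdW)
              (blkD L eV eA eB dA hdA dB hdB dV hdV hVA hVB dW hdW (x, 1))) :
            UnitaryGroup.archLocal L (2 + 2) (hermD L eV dV hdV dW hdW) σ) : GL (Fin (2 + 2)) ℂ) : Matrix (Fin (2 + 2)) (Fin (2 + 2)) ℂ) * Tinv σ =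
      ι ((fromBlocks !![1] !![1]
            !![I * (((σ.1.embedding (dV (eV.symm 1).1 * dW (eV.symm 1).2)).re / |(σ.1.embedding (dV (eV.symm 1).1 * dW (eV.symm 1).2)).re| : ℝ) : ℂ) *
              ((Real.sqrt (|(σ.1.embedding (dV (eV.symm 1).1 * dW (eV.symm 1).2)).re| / 2) : ℂ) * (Real.sqrt (|(σ.1.embedding (dV (eV.symm 1).1 * dW (eV.symm 1).2)).re| / 2) : ℂ))]
            !![-(I * (((σ.1.embedding (dV (eV.symm 1).1 * dW (eV.symm 1).2)).re / |(σ.1.embedding (dV (eV.symm 1).1 * dW (eV.symm 1).2)).re| : ℝ) : ℂ) *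
              ((Real.sqrt (|(σ.1.embedding (dV (eV.symm 1).1 * dW (eV.symm 1).2)).re| / 2) : ℂ) * (Real.sqrt (|(σ.1.embedding (dV (eV.symm 1).1 * dW (eV.symm 1).2)).re| / 2) : ℂ)))] :
            Matrix (Fin 1 ⊕ Fin 1) (Fin 1 ⊕ Fin 1) ℂ) *
          Matrix.reindex (finSumFinEquiv (m := 1) (n := 1)).symm (finSumFinEquiv (m := 1) (n := 1)).symm
            (((UnitaryGroup.archAt (Fp L) L (IsCMField.complexConj L) (1 + 1) (hermD L eA dA hdA dW hdW) σ hw (IsCMField.complexConj_ne_one L)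
                (UnitaryGroup.archPart (Fp L) L (IsCMField.complexConj L) (1 + 1) (hermD L eA dA hdA dW hdW) x) :
                UnitaryGroup.archLocal L (1 + 1) (hermD L eA dA hdA dW hdW) σ) : GL (Fin (1 + 1)) ℂ) : Matrix (Fin (1 + 1)) (Fin (1 + 1)) ℂ) *
        fromBlocks !![1 / 2]
          !![-(I * (((σ.1.embedding (dV (eV.symm 1).1 * dW (eV.symm 1).2)).re / |(σ.1.embedding (dV (eV.symm 1).1 * dW (eV.symm 1).2)).re| : ℝ) : ℂ) *
            ((((Real.sqrt (|(σ.1.embedding (dV (eV.symm 1).1 * dW (eV.symm 1).2)).re| / 2))⁻¹ : ℝ) : ℂ) *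
              (((Real.sqrt (|(σ.1.embedding (dV (eV.symm 1).1 * dW (eV.symm 1).2)).re| / 2))⁻¹ : ℝ) : ℂ)) / 2)]
          !![1 / 2]
          !![I * (((σ.1.embedding (dV (eV.symm 1).1 * dW (eV.symm 1).2)).re / |(σ.1.embedding (dV (eV.symm 1).1 * dW (eV.symm 1).2)).re| : ℝ) : ℂ) *
            ((((Real.sqrt (|(σ.1.embedding (dV (eV.symm 1).1 * dW (eV.symm 1).2)).re| / 2))⁻¹ : ℝ) : ℂ) *
              (((Real.sqrt (|(σ.1.embedding (dV (eV.symm 1).1 * dW (eV.symm 1).2)).re| / 2))⁻¹ : ℝ) : ℂ)) / 2]) := by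
  rw [reindex_archAt_blkD_inl L eV eA eB dA hdA dB hdB dV hdV hVA hVB dW hdW ι hι he σ hw x, hTdef, hTinvdef,
    adaptedFrame_eq_blockDiagonal _ ht, adaptedFrameInv_eq_blockDiagonal _ ht]
  have h11 := gamma_mul_gammaInv (fun k => (σ.1.embedding (dV (eV.symm k).1 * dW (eV.symm k).2)).re) ht 0
  exact blockDiagonalFrame_conj_corner ι hι _ _ _ _ _ _ _ _ (by norm_num) (by ring) (by ring) (by linear_combination (-1 : ℂ) * h11) _

include hι in
/-- **THE A-LINE'S WEYL ELEMENT TIMES A LINE UNIPOTENT IN THE ADAPTED FRAME** (F2δ HEAD twin at `eV (1,0) = 0`): for every complex `σ` and `u ∈ N_Δ^{(A)}(𝔸)`,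
`T′σ · (e₂⁻¹·((blkD(w_Δ·u, 1))_∞)_σ·e₂) · T′σ⁻¹ = ι( m(cτ′, cτ) · J₁ · n₁(2cτ′·x) )`, `x = (((blk u)₁₂ 0 0)_∞)_σ`, slot letters at `t₁(σ) = Re σ(dA₀·dW₀)`.
[cite: Kudla1994, §2] [cite: Shimura1997, §18.1 (18.4), §A3] [cite: HarrisKudlaSweet1996, §1 (1.11)] -/
theorem frame_archAt_blkD_inl_weyl_unip_adapted (he : eV (1, 0) = 0)
    (T Tinv : {w : InfinitePlace L // w.IsComplex} → Matrix (Fin 2 ⊕ Fin 2) (Fin 2 ⊕ Fin 2) ℂ)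
    (hTdef : ∀ σ, T σ = Matrix.fromBlocks (diagonal (fun k => (((Real.sqrt (|(σ.1.embedding (dV (eV.symm k).1 * dW (eV.symm k).2)).re| / 2))⁻¹ : ℝ) : ℂ))) 0 0
          (diagonal (fun k => (Real.sqrt (|(σ.1.embedding (dV (eV.symm k).1 * dW (eV.symm k).2)).re| / 2) : ℂ))) *
        fromBlocks (diagonal (fun k => (Real.sqrt (|(σ.1.embedding (dV (eV.symm k).1 * dW (eV.symm k).2)).re| / 2) : ℂ)))
          (diagonal (fun k => (Real.sqrt (|(σ.1.embedding (dV (eV.symm k).1 * dW (eV.symm k).2)).re| / 2) : ℂ)))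
          (diagonal (fun k => I * ((((σ.1.embedding (dV (eV.symm k).1 * dW (eV.symm k).2)).re / |(σ.1.embedding (dV (eV.symm k).1 * dW (eV.symm k).2)).re|) *
            Real.sqrt (|(σ.1.embedding (dV (eV.symm k).1 * dW (eV.symm k).2)).re| / 2) : ℝ) : ℂ)))
          (-diagonal (fun k => I * ((((σ.1.embedding (dV (eV.symm k).1 * dW (eV.symm k).2)).re / |(σ.1.embedding (dV (eV.symm k).1 * dW (eV.symm k).2)).re|) *
            Real.sqrt (|(σ.1.embedding (dV (eV.symm k).1 * dW (eV.symm k).2)).re| / 2) : ℝ) : ℂ))))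
    (hTinvdef : ∀ σ, Tinv σ = fromBlocks (diagonal (fun k => (((Real.sqrt (|(σ.1.embedding (dV (eV.symm k).1 * dW (eV.symm k).2)).re| / 2))⁻¹ / 2 : ℝ) : ℂ)))
          (-diagonal (fun k => I * (((Real.sqrt (|(σ.1.embedding (dV (eV.symm k).1 * dW (eV.symm k).2)).re| / 2))⁻¹ *
            ((σ.1.embedding (dV (eV.symm k).1 * dW (eV.symm k).2)).re / |(σ.1.embedding (dV (eV.symm k).1 * dW (eV.symm k).2)).re|) / 2 : ℝ) : ℂ)))
          (diagonal (fun k => (((Real.sqrt (|(σ.1.embedding (dV (eV.symm k).1 * dW (eV.symm k).2)).re| / 2))⁻¹ / 2 : ℝ) : ℂ)))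
          (diagonal (fun k => I * (((Real.sqrt (|(σ.1.embedding (dV (eV.symm k).1 * dW (eV.symm k).2)).re| / 2))⁻¹ *
            ((σ.1.embedding (dV (eV.symm k).1 * dW (eV.symm k).2)).re / |(σ.1.embedding (dV (eV.symm k).1 * dW (eV.symm k).2)).re|) / 2 : ℝ) : ℂ))) *
        Matrix.fromBlocks (diagonal (fun k => (Real.sqrt (|(σ.1.embedding (dV (eV.symm k).1 * dW (eV.symm k).2)).re| / 2) : ℂ))) 0 0
          (diagonal (fun k => (((Real.sqrt (|(σ.1.embedding (dV (eV.symm k).1 * dW (eV.symm k).2)).re| / 2))⁻¹ : ℝ) : ℂ))))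
    (σ : {w : InfinitePlace L // w.IsComplex}) (hw : IsCMField.complexConj L • σ.1 = σ.1)
    (ht : ∀ k, (σ.1.embedding (dV (eV.symm k).1 * dW (eV.symm k).2)).re ≠ 0) {u : HA L eA dA hdA dW hdW} (hu : u ∈ unipDelta L eA dA hdA dW hdW) :
    T σ * Matrix.reindex (finSumFinEquiv (m := 2) (n := 2)).symm (finSumFinEquiv (m := 2) (n := 2)).symm
        (((UnitaryGroup.archAt (Fp L) L (IsCMField.complexConj L) (2 + 2) (hermD L eV dV hdV dW hdW) σ hw (IsCMField.complexConj_ne_one L)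
            (UnitaryGroup.archPart (Fp L) L (IsCMField.complexConj L) (2 + 2) (hermD L eV dV hdV dW hdW)
              (blkD L eV eA eB dA hdA dB hdB dV hdV hVA hVB dW hdW (weylDelta L eA dA hdA dW hdW * u, 1))) :
            UnitaryGroup.archLocal L (2 + 2) (hermD L eV dV hdV dW hdW) σ) : GL (Fin (2 + 2)) ℂ) : Matrix (Fin (2 + 2)) (Fin (2 + 2)) ℂ) * Tinv σ =
      ι (fromBlocks !![I * (((σ.1.embedding (dV (eV.symm 1).1 * dW (eV.symm 1).2)).re / |(σ.1.embedding (dV (eV.symm 1).1 * dW (eV.symm 1).2)).re| : ℝ) : ℂ) *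
              ((((Real.sqrt (|(σ.1.embedding (dV (eV.symm 1).1 * dW (eV.symm 1).2)).re| / 2))⁻¹ : ℝ) : ℂ) * (((Real.sqrt (|(σ.1.embedding (dV (eV.symm 1).1 * dW (eV.symm 1).2)).re| / 2))⁻¹ : ℝ) : ℂ))]
            0 0
            !![I * (((σ.1.embedding (dV (eV.symm 1).1 * dW (eV.symm 1).2)).re / |(σ.1.embedding (dV (eV.symm 1).1 * dW (eV.symm 1).2)).re| : ℝ) : ℂ) *
              ((Real.sqrt (|(σ.1.embedding (dV (eV.symm 1).1 * dW (eV.symm 1).2)).re| / 2) : ℂ) * (Real.sqrt (|(σ.1.embedding (dV (eV.symm 1).1 * dW (eV.symm 1).2)).re| / 2) : ℂ))] *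
          Matrix.J (Fin 1) ℂ *
          fromBlocks 1 !![2 * (I * (((σ.1.embedding (dV (eV.symm 1).1 * dW (eV.symm 1).2)).re / |(σ.1.embedding (dV (eV.symm 1).1 * dW (eV.symm 1).2)).re| : ℝ) : ℂ)) *
              ((((Real.sqrt (|(σ.1.embedding (dV (eV.symm 1).1 * dW (eV.symm 1).2)).re| / 2))⁻¹ : ℝ) : ℂ) * (((Real.sqrt (|(σ.1.embedding (dV (eV.symm 1).1 * dW (eV.symm 1).2)).re| / 2))⁻¹ : ℝ) : ℂ)) *
              (InfiniteAdeleRing.ringEquiv_mixedSpace L ((blk L eA dA hdA dW hdW u).toBlocks₁₂ 0 0).1).2 σ] 0 1) := by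
  obtain ⟨hc, hτ⟩ := slot_letters_of_ne_zero (ht 1)
  have hmul₁ : UnitaryGroup.archPart (Fp L) L (IsCMField.complexConj L) (1 + 1) (hermD L eA dA hdA dW hdW) (weylDelta L eA dA hdA dW hdW * u) =
      UnitaryGroup.archPart (Fp L) L (IsCMField.complexConj L) (1 + 1) (hermD L eA dA hdA dW hdW) (weylDelta L eA dA hdA dW hdW) *
        UnitaryGroup.archPart (Fp L) L (IsCMField.complexConj L) (1 + 1) (hermD L eA dA hdA dW hdW) u := map_mul _ _ _
  have hmul₂ := map_mul (UnitaryGroup.archAt (Fp L) L (IsCMField.complexConj L) (1 + 1) (hermD L eA dA hdA dW hdW) σ hw (IsCMField.complexConj_ne_one L))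
    (UnitaryGroup.archPart (Fp L) L (IsCMField.complexConj L) (1 + 1) (hermD L eA dA hdA dW hdW) (weylDelta L eA dA hdA dW hdW))
    (UnitaryGroup.archPart (Fp L) L (IsCMField.complexConj L) (1 + 1) (hermD L eA dA hdA dW hdW) u)
  rw [frame_archAt_blkD_inl_adapted L eV eA eB dA hdA dB hdB dV hdV hVA hVB dW hdW ι hι he T Tinv hTdef hTinvdef σ hw ht, hmul₁, hmul₂,
    Subgroup.coe_mul, Units.val_mul, reindex_mul_reindex, reindex_archAt_weylDelta L eA dA hdA dW hdW σ hw,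
    reindex_archAt_unip_line L eA dA hdA dW hdW σ hw _ hu]
  congr 1
  rw [← weylSlot_mul_unipSlot, ← slotFrame_conj_weyl, ← slotFrame_conj_unip hc hτ]
  simp only [Matrix.mul_assoc]
  rw [← Matrix.mul_assoc (fromBlocks !![1 / 2] _ _ _) (fromBlocks !![1] _ _ _), slotFrameInv_mul_slotFrame hc hτ, Matrix.one_mul]

end Adapted

end Summit.HodgeConjecture.HodgeConjecture.Cruxes.HLiu418.K2LiuKindOneLineCornerFrameReadingInl

end
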